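import Literature.MathematicalPhysics.QuantumFieldTheory.Balaban1983to89.B13DirichletLocalRoadPadLettersLocated

/-!
# `Balaban1983to89.B13DirichletLocalRoadPadLettersExists` — T. Bałaban, *Propagators for lattice gauge theories in a background field*, Commun. Math. Phys. **99**
# (1985) 389–434 [Balaban1985BackgroundPropagators], Sect. C pp. 408–409 («G′_□(U), C_□(U), G_□(U) … satisfy all the inequalities of Theorems 3.1–3.3»), (3.87) p. 409,
# Thm 3.4 p. 400 («… extend to configurations U′U … as analytic functions of A′ … for α₁ sufficiently small»), Thm 3.10 (3.107)–(3.108) p. 416, Thm 3.11 p. 416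
# («G_□(e^{iηA}) = G_□(1)(I − V(A)G_□(1))⁻¹ … a small perturbation»); [Balaban1988RG2Cluster] (2.5)–(2.7) pp. 12–13, p. 15:
# ★★★ THE LOCAL-CUBE ROAD's LETTERS AT `U₀ = 1` WITH EVERY NUMERIC WINDOW DISCHARGED — «for α₁ sufficiently small» made a WITNESS: there are a radius `R > 0`, a rate
# `ρ > 0` and a constant `B ≥ 0`, depending on def-Y's index `i`, on `N` and on `η` ONLY (not on the cube, the block cut or the bond cut), such that
# `A′ ↦ toMatrix (padDeltaALocY i parSymY parBY D (M_{χ_P}) (M_χ) (e^{iηA′}·1))` has the N10 entry letters `(R, ρ, B)` at the bond reading for EVERY `D`, `Dblk ⊆ D`, `χ`.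

[folklore] bookkeeping: explicit witnesses (thin radii `m·R₀∕(4X+4)`, Combes–Thomas rates `min(ρ∕4, m·ρ∕(Z+1))`) for the six numeric windows of
`B13DirichletLocalRoadPadLettersLocated.rawEntryLetters_toMatrix_padDeltaALocY_parSymY_prodCfg_one_located` at `Rc = ρ = 1`; kernel-checked; THEOREMS ONLY (no `def`,
no `structure`, no instance, no notation); nothing of NODE 00's ∕ the N10 stations' files is modified or restated; nothing here is a claim about the Yang–Mills mass
gap; no node is discharged; count-neutral.

WHY THIS FILE (cell `pub-ymgap`, HUMAN RULING D-0062, Track A node N06 ← N10 local-cube road; seat `pub-ymgap-dag-n06-j` g28, the CONSUMER of row 17's `hA` slot).  Row 17's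
local clause on print's class (3.35) (`Summits/…/BalabanUVNodesN06Row17LocalCentreEveryCubeOfKIdx.posDefTr_padDeltaALocY_of_L5_of_regYP335_of_KIdx`) displayed the
letters `hA` with FREE `(loc, R, ρ, B, m_F)`; with this file they are INHABITED by cut-independent numbers, so the remaining smallness inequalities of the road
(`hsmall`, the (3.35) comparison `hCr`) become ONE «Mα₀ sufficiently small» per member — the Summits corollary `…N06Row17LocalClauseOnReg335Small` (this seat).

WHAT THIS FILE PROVES (all `theorem`s).
* ★★★ `exists_rawEntryLetters_toMatrix_padDeltaALocY_parSymY_prodCfg_one` — `∃ R > 0, ∃ ρ > 0, ∃ B ≥ 0, ∀ D Dblk (⊆ D) χ (0∕1), RawEntryLetters (A′ ↦ toMatrix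
  (padDeltaALocY i (parSymY i) (parBY i) D (cutMulY (blkIndY i Dblk)) (cutMulY χ) (prodCfg 1 η A′))) (bondReadingY i i.hN ∘ fst) R ρ B`, for `G ≤ U(N)` and every `η`.

HONEST FRAMING: witnesses for a located composition; the radius is k-DEPENDENT (dag-n10-w3 g5's LOCATED (c)) — the k-uniform edition is the (3.37)-scaled pencil (N10's
W-stations W1–W3), not this file; finite-lattice constants, not print's `O(1)`; nothing of Bałaban's asserted beyond the cited tree theorems; N06 ∕ N10 NOT discharged;
K1⁹ NOT closed, no registered stub proved; counts unmoved; 0 `def`, 0 `sorry`, standard axioms; one finite 𝕋⁴ programme at fixed ε, Bałaban AS PRINTED — R4 closes the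
conditional finite-𝕋⁴ rung `BalabanLadder.UV` only; the YM mass gap (Clay) is NOT proved by any of this; nothing continuum ∕ ℝ⁴ ∕ OS.  Filed `--kind proof --supports`
K1⁹ (stmt-QuantumFields-27364), Literature lane.

References: T. Bałaban, CMP 99 (1985) 389–434 [Balaban1985BackgroundPropagators] (3.25)–(3.26) pp.394–395, (3.35) p.396, Thm 3.4 p.400, (3.87) p.409, Sect. C
pp.408–409, (3.105) p.414, Thm 3.10 (3.107)–(3.108) p.416, Thm 3.11 p.416; CMP 116 (1988) 1–22 [Balaban1988RG2Cluster] (2.5)–(2.7) pp.12–13, p.15; CMP 96 (1984)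
223–250 [Balaban1984PropagatorsII] Lemma 2.1 (2.61) p.234, (2.69) p.235.
-/

noncomputable section

namespace Literature.MathematicalPhysics.QuantumFieldTheory.Balaban1983to89.B13DirichletLocalRoadPadLettersExists

open Metric Set Finset Module
open scoped Matrix Matrix.Norms.L2Operator
open Literature.MathematicalPhysics.QuantumFieldTheory.Balaban1983to89
open Literature.MathematicalPhysics.QuantumFieldTheory.Balaban1983to89.B9Thm37GlueTorus (tdist1)
open Literature.MathematicalPhysics.QuantumFieldTheory.Balaban1983to89.B5TorusCover (UT)
open Literature.MathematicalPhysics.QuantumFieldTheory.Balaban1983to89.B13EntrywiseWalks (RawEntryLetters)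
open Literature.MathematicalPhysics.QuantumFieldTheory.Balaban1983to89.B9Thm37CubeCoverCommutators (cutMulY)
open Literature.MathematicalPhysics.QuantumFieldTheory.Balaban1983to89.B9Thm39CubeOpsAtLettersY (blkIndY)
open Literature.MathematicalPhysics.QuantumFieldTheory.Balaban1983to89.B13BlockBondReadingNumerals (bondReadingY)
open Literature.MathematicalPhysics.QuantumFieldTheory.Balaban1983to89.B13DirichletLocalRoadPadLettersLocated
  (rawEntryLetters_toMatrix_padDeltaALocY_parSymY_prodCfg_one_located)
open Literature.MathematicalPhysics.QuantumFieldTheory.Balaban1983to89.B6RandomWalk (c0_nonneg)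
open Literature.MathematicalPhysics.QuantumFieldTheory.Balaban1983to89.B9Eq39Adjoint (prodCfg)
open Literature.MathematicalPhysics.QuantumFieldTheory.Balaban1983to89.B6GlobalChartV1 (PV)
open Literature.MathematicalPhysics.QuantumFieldTheory.Balaban1983to89.B6KLevelCensusIndexV1 (KIdx)
open Literature.MathematicalPhysics.QuantumFieldTheory.Balaban1983to89.B6Geom246MultiLevelBox (blkOf)
open Literature.MathematicalPhysics.QuantumFieldTheory.Balaban1983to89.Node00.OpsYDeltaALocal (padDeltaALocY)
open Literature.MathematicalPhysics.QuantumFieldTheory.Balaban1983to89.Node00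

/-! ## §1. Window witnesses -/

/-- a thin radius inside a window: `R = m·R₀∕(4X+4)` has `0 < R ≤ R₀` and leaves the margin `m − 2XR∕R₀ ≥ m∕2`. [folklore] -/
private theorem thin_window {m X R₀ : ℝ} (hm : 0 < m) (hm1 : m ≤ 1) (hX : 0 ≤ X) (hR₀ : 0 < R₀) :
    ∃ R : ℝ, 0 < R ∧ R ≤ R₀ ∧ m / 2 ≤ m - 2 * X * R / R₀ := by
  refine ⟨m * R₀ / (4 * X + 4), by positivity, ?_, ?_⟩
  · rw [div_le_iff₀ (by positivity)]
    nlinarith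
  · have h : 2 * X * (m * R₀ / (4 * X + 4)) / R₀ = 2 * X * m / (4 * X + 4) := by
      field_simp
    rw [h, show m - 2 * X * m / (4 * X + 4) = m * ((2 * X + 4) / (4 * X + 4)) by field_simp; ring]
    have h2 : (1 : ℝ) / 2 ≤ (2 * X + 4) / (4 * X + 4) := by
      rw [div_le_div_iff₀ (by norm_num) (by positivity)]
      nlinarith
    nlinarith

/-- a Combes–Thomas rate inside a window: `κ = min(ρ∕4, marg·ρ∕(Z+1))` has `0 < κ ≤ ρ∕4` and `Z·κ ≤ marg·ρ`. [folklore] -/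
private theorem rate_window {marg ρ Z : ℝ} (hmarg : 0 < marg) (hρ : 0 < ρ) (hZ : 0 ≤ Z) :
    ∃ κ : ℝ, 0 < κ ∧ κ ≤ ρ / 4 ∧ Z * κ ≤ marg * ρ := by
  refine ⟨min (ρ / 4) (marg * ρ / (Z + 1)), lt_min (by positivity) (by positivity), min_le_left _ _, ?_⟩
  calc Z * min (ρ / 4) (marg * ρ / (Z + 1)) ≤ Z * (marg * ρ / (Z + 1)) :=
        mul_le_mul_of_nonneg_left (min_le_right _ _) hZ
    _ = marg * ρ * (Z / (Z + 1)) := by ring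
    _ ≤ marg * ρ * 1 := by
        refine mul_le_mul_of_nonneg_left ?_ (by positivity)
        rw [div_le_one (by positivity)]
        linarith
    _ = marg * ρ := mul_one _

/-! ## §2. ★★★ The letters at `U₀ = 1` with every window discharged -/

variable {d ℓ : ℕ} {hd : 1 ≤ d + 1} {hL : Odd (ℓ + 1) ∧ 1 < ℓ + 1} {b₀ b₁ : ℝ}
variable (i : KIdx d ℓ hd hL b₀ b₁) {N : ℕ} [NeZero N] {G : Subgroup (Matrix (Fin N) (Fin N) ℂ)ˣ}

/-- ★★★ **ROW 17's LETTERS INHABITED, CUT-INDEPENDENTLY**: for `G ≤ U(N)` and every pencil parameter `η` there are `R > 0`, `ρ > 0`, `B ≥ 0` (depending on def-Y's index `i`,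
on `N` and on `η` only) with `RawEntryLetters (A′ ↦ toMatrix (padDeltaALocY i (parSymY i) (parBY i) D (cutMulY (blkIndY i Dblk)) (cutMulY χ) (prodCfg 1 η A′)))
(bondReadingY i i.hN ∘ fst) R ρ B` for EVERY site set `D`, EVERY block set `Dblk` inside `D` and EVERY 0∕1 bond cut `χ` —
`B13DirichletLocalRoadPadLettersLocated.…_one_located` at `Rc = ρ₀ = 1` with the six windows met by §1's witnesses (print's «for α₁ sufficiently small», Thm 3.4 p. 400).
[cite: Balaban1985BackgroundPropagators, Thm 3.11 proof p.416, Thm 3.4 p.400, Sect. C pp.408–409, (3.87) p.409, Thm 3.10 (3.107)–(3.108) p.416; Balaban1988RG2Cluster, (2.5)–(2.7) pp.12–13, p.15] -/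
theorem exists_rawEntryLetters_toMatrix_padDeltaALocY_parSymY_prodCfg_one
    (hG : G ≤ B7Prop2Explicit.unitaryUnits (Matrix (Fin N) (Fin N) ℂ)) (η : ℝ) :
    ∃ R : ℝ, 0 < R ∧ ∃ ρ : ℝ, 0 < ρ ∧ ∃ B : ℝ, 0 ≤ B ∧
      ∀ (D : Finset (SiteY i)) (Dblk : Finset (BlkY i)), (∀ z : SiteY i, blkOf i.D.toDomains z ∈ Dblk → z ∈ D) →
      ∀ χ : FBondY i → ℝ, (∀ bb, χ bb = 0 ∨ χ bb = 1) →
        RawEntryLetters (fun a : Fin (d + 1) → Site (PV d ℓ i.m i.K hd hL) 0 → Matrix (Fin N) (Fin N) ℂ =>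
            LinearMap.toMatrix
              ((Pi.basis fun _ : FBondY i => Matrix.stdBasis ℂ (Fin N) (Fin N)).reindex (Equiv.sigmaEquivProd (FBondY i) (Fin N × Fin N)))
              ((Pi.basis fun _ : FBondY i => Matrix.stdBasis ℂ (Fin N) (Fin N)).reindex (Equiv.sigmaEquivProd (FBondY i) (Fin N × Fin N)))
              (padDeltaALocY i (parSymY i) (parBY i) D (cutMulY (blkIndY i Dblk)) (cutMulY χ)
                (prodCfg (1 : CfgY (Matrix (Fin N) (Fin N) ℂ) i) η a)))
          (fun p : FBondY i × (Fin N × Fin N) => bondReadingY i i.hN p.1) R ρ B := by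
  -- module 78's constant at `Rc = ρ₀ = 1`
  obtain ⟨B, hB⟩ : ∃ B : ℝ, B = (1 * (((d : ℝ) + 1) *
          (1 * Real.exp (|η| * 1) * (1 * Real.exp (|η| * 1) * 1 * (1 * Real.exp (|η| * 1)) + 1) * (1 * Real.exp (|η| * 1)) +
            (1 * Real.exp (|η| * 1) * 1 * (1 * Real.exp (|η| * 1)) + 1)) +
          1 * ((1 * Real.exp (|η| * 1)) ^ (2 * (d + 1) * ((ℓ + 1) ^ i.k - 1)) * 1 * (1 * Real.exp (|η| * 1)) ^ (2 * (d + 1) * ((ℓ + 1) ^ i.k - 1)))) *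
          Real.exp (1 * (((d : ℝ) + 1) * ((((ℓ + 1) ^ i.k : ℕ) : ℝ))))) := ⟨_, rfl⟩
  have hB0 : 0 ≤ B := by rw [hB]; positivity
  -- L1's window: the centre `m₁ = min((1∕8)(L^k)⁻², 1)`, `X₁ = (B+1)·N²·c₀(1,1)^{d+1}`
  have hm₁ : 0 < min ((1 / 8 : ℝ) * (((((ℓ + 1) ^ i.k : ℕ) : ℝ)) ^ 2)⁻¹) 1 := by positivity
  have hX₁ : 0 ≤ (B + 1) * ((N * N : ℕ) * B6.c0 1 1 ^ (d + 1)) := by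
    have := c0_nonneg (1 : ℝ) 1
    positivity
  obtain ⟨R₁, hR₁, hR₁R, hm₁2⟩ := thin_window hm₁ (min_le_right _ _) hX₁ one_pos
  have hmarg₁ : 0 < min ((1 / 8 : ℝ) * (((((ℓ + 1) ^ i.k : ℕ) : ℝ)) ^ 2)⁻¹) 1 - 2 * ((B + 1) * ((N * N : ℕ) * B6.c0 1 1 ^ (d + 1))) * R₁ / 1 :=
    by linarith
  have hY₁ : 0 ≤ 8 * (B + 1) * ((N * N : ℕ) * B6.c0 1 (1 / 2) ^ (d + 1)) := by
    have := c0_nonneg (1 : ℝ) (1 / 2)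
    positivity
  obtain ⟨κ₁, hκ₁, hκ₁4, hκ₁m'⟩ := rate_window hmarg₁ one_pos hY₁
  have hκ₁m : 8 * (B + 1) * κ₁ * ((N * N : ℕ) * B6.c0 1 (1 / 2) ^ (d + 1)) ≤
      (min ((1 / 8 : ℝ) * (((((ℓ + 1) ^ i.k : ℕ) : ℝ)) ^ 2)⁻¹) 1 - 2 * ((B + 1) * ((N * N : ℕ) * B6.c0 1 1 ^ (d + 1))) * R₁ / 1) * 1 :=
    calc 8 * (B + 1) * κ₁ * ((N * N : ℕ) * B6.c0 1 (1 / 2) ^ (d + 1)) = 8 * (B + 1) * ((N * N : ℕ) * B6.c0 1 (1 / 2) ^ (d + 1)) * κ₁ := by ring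
      _ ≤ _ := hκ₁m'
  -- the X-station: `μ = κ₁∕2`, constant `B_X`
  have hμ : 0 < κ₁ / 2 := by positivity
  have hμκ : κ₁ / 2 < κ₁ := by linarith
  obtain ⟨BX, hBX⟩ : ∃ BX : ℝ, BX = 1 * (Fintype.card (Fin N × Fin N) : ℝ) *
          (1 * ((1 * Real.exp (|η| * 1)) ^ ((d + 1) * ((ℓ + 1) ^ i.k - 1)) * 1 * (1 * Real.exp (|η| * 1)) ^ ((d + 1) * ((ℓ + 1) ^ i.k - 1)))) *
        ((((ℓ : ℝ) + 1) ^ i.k) ^ (d + 1) * (Fintype.card (Fin N × Fin N) : ℝ) *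
          (1 * ((1 * Real.exp (|η| * 1)) ^ ((d + 1) * ((ℓ + 1) ^ i.k - 1)) * 1 * (1 * Real.exp (|η| * 1)) ^ ((d + 1) * ((ℓ + 1) ^ i.k - 1))))) *
        (4 / (min ((1 / 8 : ℝ) * (((((ℓ + 1) ^ i.k : ℕ) : ℝ)) ^ 2)⁻¹) 1 - 2 * ((B + 1) * ((N * N : ℕ) * B6.c0 1 1 ^ (d + 1))) * R₁ / 1) *
          (4 / (min ((1 / 8 : ℝ) * (((((ℓ + 1) ^ i.k : ℕ) : ℝ)) ^ 2)⁻¹) 1 - 2 * ((B + 1) * ((N * N : ℕ) * B6.c0 1 1 ^ (d + 1))) * R₁ / 1)) *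
          (((N * N : ℕ) : ℝ) * B6.c0 1 (κ₁ / 2) ^ (d + 1))) *
        Real.exp (2 * (κ₁ - κ₁ / 2) * (((d : ℝ) + 1) * (((((ℓ + 1) ^ i.k : ℕ) : ℝ)) - 1))) := ⟨_, rfl⟩
  have hBX0 : 0 ≤ BX := by
    have h4 : 0 ≤ 4 / (min ((1 / 8 : ℝ) * (((((ℓ + 1) ^ i.k : ℕ) : ℝ)) ^ 2)⁻¹) 1 -
        2 * ((B + 1) * ((N * N : ℕ) * B6.c0 1 1 ^ (d + 1))) * R₁ / 1) := div_nonneg (by norm_num) hmarg₁.le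
    have := c0_nonneg (1 : ℝ) (κ₁ / 2)
    rw [hBX]; positivity
  -- the C-station's window at `m = (4(d+1)+1)⁻²`
  have hmC : 0 < ((4 * ((d : ℝ) + 1) + 1) ^ 2)⁻¹ := by positivity
  have hmC1 : ((4 * ((d : ℝ) + 1) + 1) ^ 2)⁻¹ ≤ 1 := by
    apply inv_le_one_of_one_le₀
    nlinarith [show (0 : ℝ) ≤ (d : ℝ) from Nat.cast_nonneg d]
  have hκμ : 0 < κ₁ - κ₁ / 2 := by linarith
  have hX₂ : 0 ≤ (Real.sqrt ((((ℓ : ℝ) + 1) ^ i.k) ^ (d + 1)) * 1 * (BX + 1)) * (((N * N : ℕ) : ℝ) * B6.c0 1 (κ₁ - κ₁ / 2) ^ (d + 1)) := by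
    have := c0_nonneg (1 : ℝ) (κ₁ - κ₁ / 2)
    positivity
  obtain ⟨R', hR', hR'R, hmC2⟩ := thin_window hmC hmC1 hX₂ hR₁
  have hmarg : 0 < ((4 * ((d : ℝ) + 1) + 1) ^ 2)⁻¹ -
      2 * ((Real.sqrt ((((ℓ : ℝ) + 1) ^ i.k) ^ (d + 1)) * 1 * (BX + 1)) * (((N * N : ℕ) : ℝ) * B6.c0 1 (κ₁ - κ₁ / 2) ^ (d + 1))) * R' / R₁ := by
    linarith
  have hY₂ : 0 ≤ 8 * (Real.sqrt ((((ℓ : ℝ) + 1) ^ i.k) ^ (d + 1)) * 1 * (BX + 1)) * (((N * N : ℕ) : ℝ) * B6.c0 1 ((κ₁ - κ₁ / 2) / 2) ^ (d + 1)) := by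
    have := c0_nonneg (1 : ℝ) ((κ₁ - κ₁ / 2) / 2)
    positivity
  obtain ⟨κ, hκ, hκ4, hκm'⟩ := rate_window hmarg hκμ hY₂
  have hκm : 8 * (Real.sqrt ((((ℓ : ℝ) + 1) ^ i.k) ^ (d + 1)) * 1 * (BX + 1)) * κ * (((N * N : ℕ) : ℝ) * B6.c0 1 ((κ₁ - κ₁ / 2) / 2) ^ (d + 1)) ≤
      (((4 * ((d : ℝ) + 1) + 1) ^ 2)⁻¹ -
        2 * ((Real.sqrt ((((ℓ : ℝ) + 1) ^ i.k) ^ (d + 1)) * 1 * (BX + 1)) * (((N * N : ℕ) : ℝ) * B6.c0 1 (κ₁ - κ₁ / 2) ^ (d + 1))) * R' / R₁) *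
        (κ₁ - κ₁ / 2) :=
    calc 8 * (Real.sqrt ((((ℓ : ℝ) + 1) ^ i.k) ^ (d + 1)) * 1 * (BX + 1)) * κ * (((N * N : ℕ) : ℝ) * B6.c0 1 ((κ₁ - κ₁ / 2) / 2) ^ (d + 1)) =
        8 * (Real.sqrt ((((ℓ : ℝ) + 1) ^ i.k) ^ (d + 1)) * 1 * (BX + 1)) * (((N * N : ℕ) : ℝ) * B6.c0 1 ((κ₁ - κ₁ / 2) / 2) ^ (d + 1)) * κ := by ring
      _ ≤ _ := hκm'
  -- L3's rate loss `μ′ = κ∕4`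
  have hμ' : 0 < κ / 4 := by positivity
  have h2μ' : 2 * (κ / 4) < κ := by linarith
  -- the letters, at `D = ∅` for the sign of the constant and then for every cut datum
  have key := fun (D : Finset (SiteY i)) (Dblk : Finset (BlkY i)) (hDD : ∀ z : SiteY i, blkOf i.D.toDomains z ∈ Dblk → z ∈ D)
      (χ : FBondY i → ℝ) (hχ : ∀ bb, χ bb = 0 ∨ χ bb = 1) =>
    rawEntryLetters_toMatrix_padDeltaALocY_parSymY_prodCfg_one_located i hG D hDD hχ η one_pos one_pos hB hR₁ hR₁R hmarg₁ hκ₁ hκ₁4 hκ₁m hμ hμκ hBX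
      hR'.le hR'R hmarg hκ.le hκ4 hκm hμ' h2μ'
  have h0 := key ∅ ∅ (fun z hz => absurd hz (Finset.notMem_empty _)) (fun _ => 0) (fun _ => Or.inl rfl)
  exact ⟨R', hR', κ - 2 * (κ / 4), by linarith, _, h0.B_nonneg, fun D Dblk hDD χ hχ => key D Dblk hDD χ hχ⟩

end Literature.MathematicalPhysics.QuantumFieldTheory.Balaban1983to89.B13DirichletLocalRoadPadLettersExists

end
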